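import Summits.PneNP.PneNP.Theses.SzkEntropy
import Summits.PneNP.PneNP.Theorems.SzkEntropyPeaWorstToAvg
import Literature.Computability.Complexity.PolynomialEntropyApproximation
import Literature.Computability.Complexity.FoldBricks
import Literature.Computability.Complexity.PlumbingBricks
import Literature.Computability.Complexity.StackBricks
import Literature.Computability.Complexity.RandomizedProofs

/-!
# PneNP / SzkEntropy — crux `PeaWorstToAvg` (stmt-PneNP-10777), negative side: the `HeurBPP` conjunct
# of the conclusion is a NON-UNIFORM class (scheme-side advice leak) and the resulting asymmetry

Route `PneNP/SzkEntropy`, crux item stmt-PneNP-10777 (`PeaWorstToAvg`):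

  `PEA 3 ∉ PromiseBPP' → ∃ D samplable, supported on the promise, with ((PEA 3).yes, D) ∉ HeurBPP`.

Standing-disprover content (`Cruxes/PeaWorstToAvg/Disproof.lean`, §5).  The tree's probabilistic
machines (`RandAlg`) receive a coin string whose LENGTH `coinLen ℓ` is an arbitrary function of the
input length `ℓ`, only BOUNDED by a polynomial (`RandAlg.IsPolyTime`); the machine sees that length, so
it carries `O(log ℓ)` bits of advice.  The sampler side of this leak is in
`SzkEntropyPeaWorstToAvgAdviceLeak.lean` (`PSamp` is uncountable).  This file proves the SCHEME side and
draws the consequence for the crux: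

* `mem_HeurBPP_sizeClass` — for EVERY `a : ℕ → Bool` (computable or not) and EVERY ensemble `D`, the
  distributional problem `({x | a (size |x|)}, D)` is in the tree's `HeurBPP`: the scheme with coin budget
  `coinLen ℓ := Σ_{t ≤ size ℓ} a(t) 2ᵗ ≤ 4ℓ + 2` reads bit `size |x|` of its own coin COUNT (an `FP` brick
  composition: `lenBinF`, `Plumb.dropFn`, `parityFn`, `notFn`) and is correct on every input with
  probability one;
* `not_countable_heurBPP_uniformEnsemble` — hence uncountably many languages are `HeurBPP`-easy on the
  uniform ensemble (for the intended uniform class this set is `BPP`, countable): the tree's `HeurBPP` is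
  `HeurBPP` WITH `O(log)` ADVICE;
* `pea_mem_HeurBPP_of_promiseScheme` / `szkEntropy_peaWorstToAvg_iff_mem_of_promiseScheme` — consequently,
  if SOME tree scheme (advice allowed) errs with probability `< 1/4` on every PROMISE instance of `PEA₃` at
  every `(n, m)`, then every on-promise ensemble is easy and the crux is equivalent to
  `PEA 3 ∈ PromiseBPP'` (so FALSE together with its own hypothesis,
  `szkEntropy_not_peaWorstToAvg_of_promiseScheme`); `promiseScheme_of_mem_PromiseBPP'` is the uniform
  direction.  The typed crux thus asserts "`PEA₃ ∉ prBPP'` (uniform) ⇒ hardness against schemes WITH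
  advice": in a world where `coinLen`-advice decides `PEA₃` but uniform machines do not, it fails while
  the intended uniform statement may hold.  Repair note for planners: pin `coinLen` to a polynomial in
  `Randomized.lean`, or read the conclusion as `HeurBPP/log`-hardness (which is what a proof must deliver).

References: A. Bogdanov, L. Trevisan, *Average-Case Complexity* (2006), Def. 2.12–2.13 and §2.3;
S. Arora, B. Barak, *Computational Complexity* (2009), Def. 7.1–7.3 and §6.3 (advice);
R. Karp, R. Lipton, *Turing machines that take advice*, Enseign. Math. 28 (1982);
Z. Dvir, D. Gutfreund, G. N. Rothblum, S. Vadhan, *On approximating the entropy of polynomial mappings*,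
ICS 2011, pp. 2–3.
-/

namespace Summit.PneNP.PneNP.Theorems

open Literature.Computability.Complexity Literature.Computability.MetaComplexity
open Literature.Computability.Complexity.Brick
open Summit.PneNP.PneNP.Theses.SzkEntropy
open _root_.Computability

/-! ### The advice number `Σ_{t ≤ size ℓ} a(t) 2ᵗ` -/

/-- The advice number is polynomially bounded: `⟦a(0) … a(size ℓ)⟧ ≤ 4ℓ + 2`
(`2^{size ℓ} ≤ 2ℓ + 1`). [AroraBarakCC2009, §6.3] -/
theorem adviceNum_le (a : ℕ → Bool) (ℓ : ℕ) :
    bitsToNat ((List.range (ℓ.size + 1)).map a) ≤ 4 * ℓ + 2 := by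
  have h1 : bitsToNat ((List.range (ℓ.size + 1)).map a) < 2 ^ (ℓ.size + 1) := by
    simpa using bitsToNat_lt ((List.range (ℓ.size + 1)).map a)
  have h2 : 2 ^ ℓ.size ≤ 2 * ℓ + 1 := by
    rcases Nat.eq_zero_or_pos ℓ with rfl | hℓ
    · simp [Nat.size_zero]
    · have h3 : 0 < ℓ.size := Nat.size_pos.2 hℓ
      have h4 : 2 ^ (ℓ.size - 1) ≤ ℓ := Nat.lt_size.1 (by omega)
      calc 2 ^ ℓ.size = 2 * 2 ^ (ℓ.size - 1) := by
            rw [← pow_succ']; congr 1; omega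
        _ ≤ 2 * ℓ + 1 := by omega
  rw [pow_succ] at h1
  omega

/-- **Bit `t` of the advice number is `a t`** (`t ≤ size ℓ`): `⟦a(0)…a(size ℓ)⟧ / 2ᵗ` is even iff
`a t = false`. [AroraBarakCC2009, §0.1 (binary representation)] -/
theorem even_adviceNum_div_iff (a : ℕ → Bool) {ℓ t : ℕ} (ht : t ≤ ℓ.size) :
    Even (bitsToNat ((List.range (ℓ.size + 1)).map a) / 2 ^ t) ↔ a t = false := by
  have hlen : t < ((List.range (ℓ.size + 1)).map a).length := by simp; omega
  rw [← bitsToNat_drop, List.drop_eq_getElem_cons hlen, bitsToNat_cons]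
  have hget : ((List.range (ℓ.size + 1)).map a)[t] = a t := by simp
  rw [hget]
  cases a t <;> simp [Nat.even_add]

/-! ### The string machine: bit `size |x|` of the coin count -/

/-- **The advice-reading machine is an `FP` brick**: on `⟨⟨x, y⟩, r⟩` it outputs the bit
`¬ Even(|r| / 2^{size |x|})`, i.e. bit `size |x|` of its coin count (`lenBinF`, `fanoutFn`,
`Plumb.dropFn`, `parityFn`, `notFn`). [AroraBarakCC2009, §1.2 and §6.3] -/
theorem adviceMachine_mem_FP :
    notFn (Brick.parityFn ∘ Plumb.dropFn ∘ fanoutFn (lenBinF ∘ fstF ∘ fstF) (lenBinF ∘ sndF)) ∈ FP :=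
  notFn_mem_FP (comp_mem_FP Brick.parityFn_mem_FP (comp_mem_FP Plumb.dropFn_mem_FP
    (fanoutFn_mem_FP (comp_mem_FP lenBinF_mem_FP (comp_mem_FP fstF_mem_FP fstF_mem_FP))
      (comp_mem_FP lenBinF_mem_FP sndF_mem_FP))))

/-- Value of the advice-reading machine on `⟨⟨x, y⟩, r⟩`. [folklore] -/
theorem adviceMachine_apply (x y r : List Bool) :
    notFn (Brick.parityFn ∘ Plumb.dropFn ∘ fanoutFn (lenBinF ∘ fstF ∘ fstF) (lenBinF ∘ sndF))
        (boolPair (boolPair x y) r) = [!decide (Even (r.length / 2 ^ x.length.size))] := by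
  have h1 : (Brick.parityFn ∘ Plumb.dropFn ∘ fanoutFn (lenBinF ∘ fstF ∘ fstF) (lenBinF ∘ sndF))
      (boolPair (boolPair x y) r) = [decide (Even (r.length / 2 ^ x.length.size))] := by
    simp only [Function.comp_apply, fanoutFn_apply, fstF_boolPair, sndF_boolPair, lenBinF_apply,
      Plumb.dropFn_boolPair, Brick.parityFn, bitsToNat_drop, bitsToNat_encodeNat,
      TM2Pass.length_encodeNat_eq_size]
  rw [notFn_apply h1]

/-! ### The advice scheme decides every size-class language, on every ensemble -/

/-- **The advice scheme for `a` is a probabilistic polynomial-time scheme** in the tree's sense: run map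
= the advice-reading machine (on all coin strings), coin budget `ℓ ↦ ⟦a(0)…a(size ℓ)⟧ ≤ 4ℓ + 2`.
[AroraBarakCC2009, Def. 7.3 and §6.3; BogdanovTrevisan2006, Def. 2.12] -/
theorem adviceScheme_isPolyTime (a : ℕ → Bool) :
    (⟨fun q r => !decide (Even (r.length / 2 ^ q.1.length.size)),
        fun ℓ => bitsToNat ((List.range (ℓ.size + 1)).map a)⟩ :
      RandAlg (List Bool × ℕ × ℕ) Bool).IsPolyTime schemeEnc encodeBool := by
  refine ⟨?_, 4 * Polynomial.X + 2, fun ℓ => by simpa using adviceNum_le a ℓ⟩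
  refine PolyTimeComputable.of_encode_eq
    (f := notFn (Brick.parityFn ∘ Plumb.dropFn ∘ fanoutFn (lenBinF ∘ fstF ∘ fstF) (lenBinF ∘ sndF)))
    (fun p : (List Bool × ℕ × ℕ) × List Bool => boolPair (schemeEnc p.1) p.2)
    (fun _ => rfl) (fun p => ?_) adviceMachine_mem_FP
  obtain ⟨⟨x, n, m⟩, r⟩ := p
  simp only [schemeEnc, id, Function.uncurry]
  rw [adviceMachine_apply]
  rfl

/-- **Output law of the advice scheme**: on `(x, 1ⁿ, 1ᵐ)` it outputs `a (size |x|)` with probability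
one — the coin COUNT is the advice number of `ℓ = |⟨x, 1ⁿ, 1ᵐ⟩| ≥ |x|`, whose bit `size |x| ≤ size ℓ` is
`a (size |x|)`; no coin VALUE is read. [AroraBarakCC2009, §6.3] -/
theorem adviceScheme_outputPMF (a : ℕ → Bool) (x : List Bool) (n m : ℕ) :
    (⟨fun q r => !decide (Even (r.length / 2 ^ q.1.length.size)),
        fun ℓ => bitsToNat ((List.range (ℓ.size + 1)).map a)⟩ :
      RandAlg (List Bool × ℕ × ℕ) Bool).outputPMF schemeEnc (x, n, m) = PMF.pure (a x.length.size) := by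
  unfold RandAlg.outputPMF
  have hℓ : x.length ≤ (schemeEnc (x, n, m)).length := by
    simp [schemeEnc, length_boolPair]
    omega
  have ht : x.length.size ≤ (schemeEnc (x, n, m)).length.size := Nat.size_le_size hℓ
  rw [show (fun r : List.Vector Bool (bitsToNat ((List.range ((schemeEnc (x, n, m)).length.size + 1)).map a)) =>
      (!decide (Even (r.toList.length / 2 ^ x.length.size)))) = fun _ => a x.length.size from ?_]
  · exact PMF.map_const _ _
  funext r
  rw [List.Vector.toList_length]
  cases h : a x.length.size
  · simpa [h] using (even_adviceNum_div_iff a ht).2 h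
  · have : ¬ Even (bitsToNat ((List.range ((schemeEnc (x, n, m)).length.size + 1)).map a) /
        2 ^ x.length.size) := by
      rw [even_adviceNum_div_iff a ht, h]
      decide
    simp [this]

/-- **Every size-class language is `HeurBPP`-easy on every ensemble, in the tree's model.** For every
`a : ℕ → Bool` — no computability assumed — and every ensemble `D`, `({x | a (size |x|) = true}, D) ∈
HeurBPP`: the advice scheme has NO bad input at all (error probability `0 < 1/4` everywhere).  For the
intended uniform class this fails as soon as `a` is not computable. [BogdanovTrevisan2006,
Def. 2.12–2.13; AroraBarakCC2009, §6.3; KarpLipton1982] -/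
theorem mem_HeurBPP_sizeClass (a : ℕ → Bool) (D : Ensemble) :
    (⟨{x | a x.length.size = true}, D⟩ : DistProblem) ∈ HeurBPP := by
  refine ⟨⟨fun q r => !decide (Even (r.length / 2 ^ q.1.length.size)),
      fun ℓ => bitsToNat ((List.range (ℓ.size + 1)).map a)⟩, adviceScheme_isPolyTime a,
    fun n m hm => ?_⟩
  have hind : ∀ x : List Bool,
      ({x | a x.length.size = true} : Set (List Bool)).boolIndicator x = a x.length.size := by
    intro x
    cases h : a x.length.size
    · exact (Set.notMem_iff_boolIndicator _ x).1 (by simp [h])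
    · exact (Set.mem_iff_boolIndicator _ x).1 (by simp [h])
  have hzero : ∀ x : List Bool,
      (⟨fun q r => !decide (Even (r.length / 2 ^ q.1.length.size)),
          fun ℓ => bitsToNat ((List.range (ℓ.size + 1)).map a)⟩ :
        RandAlg (List Bool × ℕ × ℕ) Bool).pr schemeEnc (x, n, m)
        {b | b ≠ ({x | a x.length.size = true} : Set (List Bool)).boolIndicator x} = 0 := by
    intro x
    rw [RandAlg.pr, adviceScheme_outputPMF, PMF.toOuterMeasure_pure_apply, hind x]
    simp
  have hempty : {x | 1 / 4 ≤ (⟨fun q r => !decide (Even (r.length / 2 ^ q.1.length.size)),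
        fun ℓ => bitsToNat ((List.range (ℓ.size + 1)).map a)⟩ :
          RandAlg (List Bool × ℕ × ℕ) Bool).pr schemeEnc (x, n, m)
        {b | b ≠ ({x | a x.length.size = true} : Set (List Bool)).boolIndicator x}} = ∅ := by
    ext x
    simp only [Set.mem_setOf_eq, hzero x, Set.mem_empty_iff_false, iff_false, not_le]
    norm_num
  change D.prob n _ ≤ 1 / m
  rw [hempty, Ensemble.prob, PMF.toOuterMeasure_apply]
  simp

/-- **Uncountably many languages are `HeurBPP`-easy on the uniform ensemble** (tree model): the
injective family `a ↦ {x | a (size |x|)}` of ALL of `ℕ → Bool` lies inside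
`{L | (L, U) ∈ HeurBPP}` (`mem_HeurBPP_sizeClass`; injectivity via the strings `0^{2^{t-1}}` of size
class `t`), and `ℕ → Bool` is uncountable (Cantor).  In the uniform model this set is `BPP`, which is
countable — the tree's `HeurBPP` is `HeurBPP` with `O(log)` advice. [KarpLipton1982;
BogdanovTrevisan2006, Def. 2.12; AroraBarakCC2009, §6.3] -/
theorem not_countable_heurBPP_uniformEnsemble :
    ¬ {L : Language Bool | (⟨L, uniformEnsemble⟩ : DistProblem) ∈ HeurBPP}.Countable := by
  intro hcount
  -- witnesses of each size class: |w t| has size t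
  let w : ℕ → List Bool := fun t => List.replicate (2 ^ t / 2) false
  have hw : ∀ t, (w t).length.size = t := by
    intro t
    simp only [w, List.length_replicate]
    rcases Nat.eq_zero_or_pos t with rfl | ht
    · simp [Nat.size_zero]
    · have : 2 ^ t / 2 = 2 ^ (t - 1) := by
        rw [show t = (t - 1) + 1 from by omega, pow_succ]
        simp
      rw [this, Nat.size_pow]
      omega
  let Φ : (ℕ → Bool) → Set (List Bool) := fun a => {x | a x.length.size = true}
  have hΦ : Function.Injective Φ := by
    intro a b hab
    funext t
    have h1 : (w t ∈ Φ a) = (w t ∈ Φ b) := by rw [hab]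
    simp only [Φ, Set.mem_setOf_eq, hw] at h1
    cases ha : a t <;> cases hb : b t <;> simp_all
  have hrange : Set.range Φ ⊆ {L : Language Bool | (⟨L, uniformEnsemble⟩ : DistProblem) ∈ HeurBPP} := by
    rintro _ ⟨a, rfl⟩
    exact mem_HeurBPP_sizeClass a uniformEnsemble
  have hc : (Set.range Φ).Countable := hcount.mono hrange
  haveI : Countable (Set.range Φ) := hc.to_subtype
  have hinj : Function.Injective (fun a : ℕ → Bool => (⟨Φ a, a, rfl⟩ : Set.range Φ)) :=
    fun a b h => hΦ (congrArg Subtype.val h)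
  haveI : Countable (ℕ → Bool) := hinj.countable
  obtain ⟨e, he⟩ := exists_surjective_nat (ℕ → Bool)
  obtain ⟨k, hk⟩ := he fun n => !(e n n)
  have h := congrFun hk k
  cases h' : e k k <;> simp [h'] at h

/-! ### Consequence for the crux: the promise-scheme world -/

/-- **A tree scheme correct on every promise instance makes every on-promise ensemble easy.** If some
`RandAlg` scheme (advice allowed) errs with probability `< 1/4` on every `x ∈ (PEA d).yes ∪ (PEA d).no`
at every `(n, m)`, `m > 0`, then `((PEA d).yes, D) ∈ HeurBPP` for every ensemble supported on the
promise (bad set disjoint from the support, probability `0`). [BogdanovTrevisan2006, §2.3 and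
Def. 2.12–2.13] -/
theorem pea_mem_HeurBPP_of_promiseScheme (d : ℕ)
    (h : ∃ A : RandAlg (List Bool × ℕ × ℕ) Bool, A.IsPolyTime schemeEnc encodeBool ∧
      ∀ (n m : ℕ), 0 < m → ∀ x : List Bool, (x ∈ (PEA d).yes ∨ x ∈ (PEA d).no) →
        A.pr schemeEnc (x, n, m) {b | b ≠ (PEA d).yes.boolIndicator x} < 1 / 4)
    (D : Ensemble) (hD : ∀ n : ℕ, ∀ w ∈ (D n).support, w ∈ (PEA d).yes ∨ w ∈ (PEA d).no) :
    (⟨(PEA d).yes, D⟩ : DistProblem) ∈ HeurBPP := by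
  obtain ⟨A, hA, hcorr⟩ := h
  refine ⟨A, hA, fun n m hm => ?_⟩
  have hdisj : Disjoint (D n).support
      {x | 1 / 4 ≤ A.pr schemeEnc (x, n, m) {b | b ≠ (PEA d).yes.boolIndicator x}} :=
    Set.disjoint_left.2 fun x hx hbad => absurd hbad (not_le.2 (hcorr n m hm x (hD n x hx)))
  change D.prob n {x | 1 / 4 ≤ A.pr schemeEnc (x, n, m) {b | b ≠ (PEA d).yes.boolIndicator x}} ≤ 1 / m
  rw [Ensemble.prob, (PMF.toOuterMeasure_apply_eq_zero_iff _ _).2 hdisj, ENNReal.toReal_zero]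
  positivity

/-- **The uniform direction**: `PEA d ∈ PromiseBPP'` gives such a promise scheme (amplify on the promise
to error `≤ 1/8`, lift to scheme inputs ignoring `1ⁿ, 1ᵐ`: `exists_randAlg_promise_error_le`,
`RandAlg.pr_schemeLift`).  The converse is NOT claimed — a promise scheme may use its `coinLen`-advice.
[AroraBarakCC2009, Thm 7.10; BogdanovTrevisan2006, §2.3] -/
theorem promiseScheme_of_mem_PromiseBPP' (d : ℕ) (h : PEA d ∈ PromiseBPP') :
    ∃ A : RandAlg (List Bool × ℕ × ℕ) Bool, A.IsPolyTime schemeEnc encodeBool ∧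
      ∀ (n m : ℕ), 0 < m → ∀ x : List Bool, (x ∈ (PEA d).yes ∨ x ∈ (PEA d).no) →
        A.pr schemeEnc (x, n, m) {b | b ≠ (PEA d).yes.boolIndicator x} < 1 / 4 := by
  obtain ⟨A, hA, hq, hobl, herr⟩ :=
    exists_randAlg_promise_error_le (PEA_disjoint d) h (by norm_num : (0 : ℝ) < 1 / 8)
  refine ⟨A.schemeLift, hA.schemeLift polyTimeComputable_schemeEnc_dropParams_holds,
    fun n m _ x hx => ?_⟩
  rw [A.pr_schemeLift hq hobl]
  have := herr x hx
  linarith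

/-- **The crux in the promise-scheme world.** If `PEA₃` has a promise scheme in the tree's model (advice
allowed), then `PeaWorstToAvg ↔ PEA 3 ∈ PromiseBPP'`: the typed crux then asserts exactly that advice
does not help, a `prBPP/log → prBPP'` statement foreign to the intended uniform crux.
[AroraBarakCC2009, §6.3; BogdanovTrevisan2006, Def. 2.12; DvirGutfreundRothblumVadhan2010, pp. 2–3] -/
theorem szkEntropy_peaWorstToAvg_iff_mem_of_promiseScheme
    (h : ∃ A : RandAlg (List Bool × ℕ × ℕ) Bool, A.IsPolyTime schemeEnc encodeBool ∧
      ∀ (n m : ℕ), 0 < m → ∀ x : List Bool, (x ∈ (PEA 3).yes ∨ x ∈ (PEA 3).no) →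
        A.pr schemeEnc (x, n, m) {b | b ≠ (PEA 3).yes.boolIndicator x} < 1 / 4) :
    PeaWorstToAvg ↔ PEA 3 ∈ PromiseBPP' := by
  constructor
  · intro hc
    by_contra hB
    obtain ⟨D, -, hsupp, hD⟩ := szkEntropy_peaWorstToAvg_iff.1 hc hB
    exact hD (pea_mem_HeurBPP_of_promiseScheme 3 h D hsupp)
  · intro hB
    exact szkEntropy_peaWorstToAvg_iff.2 fun hn => absurd hB hn

/-- **In the world "advice decides `PEA₃`, uniform machines do not" the typed crux is FALSE.**
[AroraBarakCC2009, §6.3; DvirGutfreundRothblumVadhan2010, pp. 2–3] -/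
theorem szkEntropy_not_peaWorstToAvg_of_promiseScheme
    (h : ∃ A : RandAlg (List Bool × ℕ × ℕ) Bool, A.IsPolyTime schemeEnc encodeBool ∧
      ∀ (n m : ℕ), 0 < m → ∀ x : List Bool, (x ∈ (PEA 3).yes ∨ x ∈ (PEA 3).no) →
        A.pr schemeEnc (x, n, m) {b | b ≠ (PEA 3).yes.boolIndicator x} < 1 / 4)
    (hB : PEA 3 ∉ PromiseBPP') : ¬ PeaWorstToAvg :=
  fun hc => hB ((szkEntropy_peaWorstToAvg_iff_mem_of_promiseScheme h).1 hc)

end Summit.PneNP.PneNP.Theorems
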